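import Mathlib
import Literature.NumberTheory.LFunctions.Zhang2022.DetectorTemplate
import HarnessLib

/-!
# Zhang (2022), programme F-S3 (cell landau-siegel, family B-det): configuration-valid ENDGAMES —
# the endgame side of the model barrier det-E5 (`E-det-model`)

Y. Zhang, *Discrete mean estimates and the Landau–Siegel zero*, arXiv:2211.02515v1
[Zhang2022LandauSiegel] — an unrefereed manuscript under adjudication. **WHAT THIS IS NOT: not a
claim about Theorems 1–2 of arXiv:2211.02515, about Landau–Siegel zeros, or about Parity; nothing
here asserts any claim of the manuscript, and nothing here asserts the model barrier.** «The
programme SEARCHES and TYPES; no claim about Landau–Siegel zeros, Theorems 1–2 of arXiv:2211.02515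
or a repaired Margin232 until a kernel theorem says so.»

Row **det-E5** of `B-det/EDLIST.md` v1, ENDGAME SIDE, typed in the shape asked for by the cell's
referee (ls-ref-1, VERDICTS.md §10: «inequalities valid for every finite non-negative-weight zero
configuration — then part (2) of the row is automatic and the theorem is the faithfulness
`m_d = E_fence[d]` alone; CS is not configuration-universal for SIGNED detector weights»):

* `Det.GramData r` — the `r × r` array of pairwise sesquilinear means `Ξ(u_a, u_b)` of `r` test
  families (the data every support-`≤ 2` endgame of §2 consumes: (2.16)–(2.19), (2.32)–(2.34));
  `Det.configGram Z w u` — the Gram array of a FINITE WEIGHTED ZERO CONFIGURATION (`Z` finite,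
  weights `w`, test values `u_a`), i.e. `(a,b) ↦ Det.discreteForm Z w (u a) (u b)`.
* `Det.ConfigValid Φ` — an endgame objective `Φ : GramData r → ℝ` (the design «closes» iff `Φ < 0`)
  is CONFIGURATION-VALID iff `0 ≤ Φ(configGram Z w u)` for EVERY finite configuration with weights
  `w ≥ 0`. PROVED instances: `configValid_pos` (one mean of `|u|²`, the POS endgame),
  `configValid_cauchySchwarz` (the CS endgame (2.18)–(2.19)/(2.34): `Re Ξ(u,u)·Re Ξ(v,v) − |Ξ(u,v)|²`,
  by `Det.norm_sq_discreteForm_le`), closure under `+` and under scaling by `c ≥ 0`.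
* Part (2) of det-E5 made AUTOMATIC: `ConfigValid.nonneg_normalised` (a configuration normalised by a
  scale `X > 0` is again a non-negative configuration) and **`ConfigValid.mainOrder_nonneg`**: if the
  normalised Gram arrays of a family of non-negative configurations converge to `m`, and `Φ` is
  configuration-valid and continuous, then `0 ≤ Φ(m)` — no configuration-valid endgame closes at
  main order on means that ARE (limits of) non-negative configuration values. With
  `Det.ModelBarrier` (faithfulness, `DetectorClassDET.lean`) this is the whole KILL certificate for
  designs whose fence weights are `≥ 0`; for SIGNED weights (PLAN §0 W3) CS-type objectives are not
  configuration-universal and the model check is per design (PLAN §3 D2) — nothing of that is typed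
  as a general statement.
* v3 (referee Q3 2026-08-26T19:28:29Z): LINEAR statistics too — `Det.LinData q`, `Det.configLin Z w f`
  (`a ↦ Σ w f_a`, the data of TURÁN-II / ONE-SIDED / LV-COUNT endgames), `Det.ConfigValidOn 𝒞 Φ`
  (a joint objective on (linear, Gram) data of ONE configuration, valid on a constraint `𝒞` on the
  points / test values), `ConfigValid.validOn`, `configLin_div`, and
  **`ConfigValidOn.mainOrder_nonneg`** (scale-invariant `𝒞`, jointly continuous `Φ` ⇒ `0 ≤ Φ(ℓ, m)`
  at the limit of normalised admissible non-negative configurations) — so every PLAN §4 endgame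
  that is a universally valid inequality on one configuration's statistics is a kernel instance.
* `not_cauchySchwarz_signed` — the kernel form of the referee's flag (F-det-6): on SIGNED weights the
  CS objective can be negative (two points, weights `±1`), so sign-indefinite detectors (PLAN §0 W3)
  are outside everything above and are checked per design (PLAN §3 D2).
* The skeleton link: for a `Positive` detector (`DetTemplate.Detector.Positive`) the Gram array of its
  discrete means IS a `configGram` (`Detector.gram_eq_configGram`, from the bridge
  `DetTemplate.mean_eq_discreteForm`), hence **`Detector.Positive.endgame_nonneg`**: for all large `D`,
  every configuration-valid endgame is `≥ 0` on the detector's means EXACTLY (generalising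
  `Detector.Positive.cauchySchwarz` from CS to every valid endgame: Gram minors, Hölder-type, …, once
  proved valid).

Elementary (finite sums, limits); 0 named facts, 0 sorries.

## References

* Y. Zhang, arXiv:2211.02515v1 (2022), §2 (2.16)–(2.19), (2.32)–(2.34). [cite: Zhang2022LandauSiegel, §2]
* Cell documents (not literature): `B-det/PLAN.md` v1 §1 (P1), §4; `B-det/EDLIST.md` v1 det-E5;
  `theory/LEVERS.md` v2.2 §0.6 (B1)–(B4), L14.
-/

noncomputable section

open Complex Real ComplexConjugate Filter
open scoped Topology

namespace Literature.NumberTheory.LFunctions.Zhang2022.Det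

/-! ## Gram arrays of finite weighted configurations; configuration-valid endgames -/

/-- **The Gram array** of `r` test families: `(a,b) ↦ Ξ(u_a,u_b)` — the data of every support-`≤ 2`
endgame ((2.16)–(2.19), (2.32)–(2.34)). [cite: Zhang2022LandauSiegel, §2 (2.16)–(2.17)] -/
abbrev GramData (r : ℕ) := Fin r → Fin r → ℂ

/-- **The Gram array of a finite weighted zero configuration** (`Z` finite, weights `w`, test values
`u_a` at the points): `(a,b) ↦ Ξ_w(u_a,u_b) = Σ_{ρ∈Z} w(ρ)u_a(ρ)conj u_b(ρ)` (`Det.discreteForm`).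
[cite: Zhang2022LandauSiegel, §2 (2.16)–(2.17)] -/
def configGram {ι : Type*} {r : ℕ} (Z : Finset ι) (w : ι → ℝ) (u : Fin r → ι → ℂ) : GramData r :=
  fun a b => discreteForm Z w (u a) (u b)

/-- **A configuration-valid endgame**: an objective `Φ` on Gram arrays (the design «closes» iff
`Φ < 0`) such that `0 ≤ Φ` on the Gram array of EVERY finite configuration with non-negative weights
(index types in `Type`, which covers the skeleton's sampled pairs `(ψ,ρ)`). The §2 endgame
«(2.18) ∧ (2.32)–(2.34) ⇒ contradiction» is the negation of such an inequality (CS) on three means.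
[cite: Zhang2022LandauSiegel, §2 (2.18)–(2.19), (2.34)] -/
def ConfigValid {r : ℕ} (Φ : GramData r → ℝ) : Prop :=
  ∀ {ι : Type} (Z : Finset ι) (w : ι → ℝ), (∀ ρ ∈ Z, 0 ≤ w ρ) → ∀ u : Fin r → ι → ℂ,
    0 ≤ Φ (configGram Z w u)

/-- **The POS endgame objective** on one family `a`: `Re Ξ(u_a,u_a)` (a non-negatively weighted mean
of `|u_a|²` forced negative would close; (2.16), (2.32)). [cite: Zhang2022LandauSiegel, §2 (2.16), (2.32)] -/
def posEndgame {r : ℕ} (a : Fin r) (G : GramData r) : ℝ := (G a a).re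

/-- **The Cauchy–Schwarz endgame objective** on families `a, b`:
`Re Ξ(u_a,u_a)·Re Ξ(u_b,u_b) − |Ξ(u_a,u_b)|²` (negative iff the CS closing inequality
`Ξ(u,u)Ξ(v,v) < |Ξ(u,v)|²` of the §2 endgame holds). [cite: Zhang2022LandauSiegel, §2 (2.18)–(2.19), (2.34)] -/
def csEndgame {r : ℕ} (a b : Fin r) (G : GramData r) : ℝ := (G a a).re * (G b b).re - ‖G a b‖ ^ 2

/-- POS is configuration-valid (`Det.discreteForm_self_nonneg`). [cite: Zhang2022LandauSiegel, §2 (2.16)] -/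
theorem configValid_pos {r : ℕ} (a : Fin r) : ConfigValid (posEndgame a) :=
  fun Z w hw u => discreteForm_self_nonneg (Z := Z) (w := w) hw (u a)

/-- **CS is configuration-valid** — the exact Cauchy–Schwarz (B1) `Det.norm_sq_discreteForm_le`.
[cite: Zhang2022LandauSiegel, §2 (2.18)–(2.19)] -/
theorem configValid_cauchySchwarz {r : ℕ} (a b : Fin r) : ConfigValid (csEndgame a b) :=
  fun Z w hw u => sub_nonneg.mpr (norm_sq_discreteForm_le (Z := Z) (w := w) hw (u a) (u b))

/-- Configuration-valid objectives are closed under addition. [cite: Zhang2022LandauSiegel, §2 (2.18)–(2.19)] -/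
theorem ConfigValid.add {r : ℕ} {Φ Ψ : GramData r → ℝ} (hΦ : ConfigValid Φ) (hΨ : ConfigValid Ψ) :
    ConfigValid (fun G => Φ G + Ψ G) :=
  fun Z w hw u => add_nonneg (hΦ Z w hw u) (hΨ Z w hw u)

/-- Configuration-valid objectives are closed under scaling by `c ≥ 0`. [cite: Zhang2022LandauSiegel, §2 (2.18)–(2.19)] -/
theorem ConfigValid.smul {r : ℕ} {Φ : GramData r → ℝ} (hΦ : ConfigValid Φ) {c : ℝ} (hc : 0 ≤ c) :
    ConfigValid (fun G => c * Φ G) :=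
  fun Z w hw u => mul_nonneg hc (hΦ Z w hw u)

/-! ## Part (2) of det-E5 is automatic: normalisation and main order -/

/-- Normalising a configuration's Gram array by a real scale `X` is the Gram array of the SAME
configuration with weights `w/X`. [cite: Zhang2022LandauSiegel, §2 (2.16)–(2.17)] -/
theorem configGram_div {ι : Type*} {r : ℕ} (Z : Finset ι) (w : ι → ℝ) (u : Fin r → ι → ℂ) (X : ℝ)
    (a b : Fin r) :
    configGram Z w u a b / (X : ℂ) = configGram Z (fun ρ => w ρ / X) u a b := by
  simp only [configGram, discreteForm, Finset.sum_div]
  refine Finset.sum_congr rfl fun ρ _ => ?_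
  push_cast
  ring

/-- A configuration-valid objective is `≥ 0` on every NORMALISED Gram array of a non-negative
configuration (`X > 0`). [cite: Zhang2022LandauSiegel, §2 (2.18)–(2.19)] -/
theorem ConfigValid.nonneg_normalised {r : ℕ} {Φ : GramData r → ℝ} (hΦ : ConfigValid Φ)
    {ι : Type} (Z : Finset ι) (w : ι → ℝ) (hw : ∀ ρ ∈ Z, 0 ≤ w ρ) (u : Fin r → ι → ℂ) {X : ℝ}
    (hX : 0 < X) : 0 ≤ Φ (fun a b => configGram Z w u a b / (X : ℂ)) := by
  have h := hΦ Z (fun ρ => w ρ / X) (fun ρ hρ => div_nonneg (hw ρ hρ) hX.le) u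
  simpa only [configGram_div] using h

/-- **det-E5 part (2), main order, AUTOMATIC for configuration values**: along any filter of stages
`s` (the manuscript: `D → ∞` under (A)) carrying finite non-negative configurations `(Z s, w s, u s)`
and scales `X s > 0` (the manuscript: `𝔞𝔓`), if the normalised Gram arrays converge to `m`, then every
CONTINUOUS configuration-valid endgame satisfies `0 ≤ Φ(m)`: no such endgame closes at main order on
means that are limits of non-negative configuration values (the general form of (B2),
`Det.not_mainOrder_closing`). [cite: Zhang2022LandauSiegel, §2 (2.18)–(2.19), Props 2.4–2.6 p. 6] -/
theorem ConfigValid.mainOrder_nonneg {r : ℕ} {Φ : GramData r → ℝ} (hΦ : ConfigValid Φ)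
    (hcont : Continuous Φ) {α : Type*} {l : Filter α} [l.NeBot] {ι : Type} (Z : α → Finset ι)
    (w : α → ι → ℝ) (u : α → Fin r → ι → ℂ) (X : α → ℝ)
    (hw : ∀ᶠ s in l, ∀ ρ ∈ Z s, 0 ≤ w s ρ) (hX : ∀ᶠ s in l, 0 < X s) {m : GramData r}
    (hlim : Tendsto (fun s => fun a b => configGram (Z s) (w s) (u s) a b / (X s : ℂ)) l (𝓝 m)) :
    0 ≤ Φ m := by
  have hT : Tendsto (fun s => Φ fun a b => configGram (Z s) (w s) (u s) a b / (X s : ℂ)) l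
      (𝓝 (Φ m)) := (hcont.tendsto m).comp hlim
  refine ge_of_tendsto hT ?_
  filter_upwards [hw, hX] with s hws hXs
  exact hΦ.nonneg_normalised (Z s) (w s) hws (u s) hXs

/-- Contrapositive («no configuration-valid endgame closes at main order»).
[cite: Zhang2022LandauSiegel, §2 (2.18)–(2.19), Props 2.4–2.6 p. 6] -/
theorem ConfigValid.not_mainOrder_closing {r : ℕ} {Φ : GramData r → ℝ} (hΦ : ConfigValid Φ)
    (hcont : Continuous Φ) {α : Type*} {l : Filter α} [l.NeBot] {ι : Type} (Z : α → Finset ι)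
    (w : α → ι → ℝ) (u : α → Fin r → ι → ℂ) (X : α → ℝ)
    (hw : ∀ᶠ s in l, ∀ ρ ∈ Z s, 0 ≤ w s ρ) (hX : ∀ᶠ s in l, 0 < X s) {m : GramData r}
    (hlim : Tendsto (fun s => fun a b => configGram (Z s) (w s) (u s) a b / (X s : ℂ)) l (𝓝 m)) :
    ¬ Φ m < 0 :=
  not_lt.mpr (hΦ.mainOrder_nonneg hcont Z w u X hw hX hlim)

/-! ## v3 · Linear + sesquilinear statistics of ONE configuration; validity under a constraint (referee Q3) -/

/-- **Linear data** of `q` test families: `a ↦ Σ_ρ w(ρ) f_a(ρ)` — the support-`1` statistics the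
TURÁN-II / ONE-SIDED / LV-COUNT endgames consume (power sums `Σ_ρ b_ρ z_ρ^ν` over a `ν`-range are
`q` such sums with `f_ν(ρ) = z_ρ^ν`; counts are sums of indicator values).
[cite: Zhang2022LandauSiegel, §2 (2.16)] -/
abbrev LinData (q : ℕ) := Fin q → ℂ

/-- The linear data of a finite weighted configuration: `configLin Z w f a = Σ_{ρ∈Z} w(ρ)·f_a(ρ)`.
[cite: Zhang2022LandauSiegel, §2 (2.16)] -/
def configLin {ι : Type*} {q : ℕ} (Z : Finset ι) (w : ι → ℝ) (f : Fin q → ι → ℂ) : LinData q :=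
  fun a => ∑ ρ ∈ Z, (w ρ : ℂ) * f a ρ

/-- **Validity under a constraint.** A joint objective `Φ` on (linear data, Gram data) of ONE
configuration is valid ON the constraint `𝒞` (a predicate on the configuration `(Z, w, f, u)`:
e.g. «`|f_ν(ρ)| ≥ 1`», «`n` points», «`f_ν = z^ν` for a common `z`») iff `0 ≤ Φ` on every finite
NON-NEGATIVELY weighted configuration satisfying `𝒞`. `ConfigValid Φ` is the case `q = 0`, `𝒞 = ⊤`
(`ConfigValid.validOn`). Turán's inequalities (`PowerSum.exists_powerSum_ge_max`, …) are of this
shape with their printed constraints; nothing here asserts any particular instance.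
[cite: Zhang2022LandauSiegel, §2 (2.16)–(2.19)] -/
def ConfigValidOn {q r : ℕ}
    (𝒞 : ∀ {ι : Type}, Finset ι → (ι → ℝ) → (Fin q → ι → ℂ) → (Fin r → ι → ℂ) → Prop)
    (Φ : LinData q → GramData r → ℝ) : Prop :=
  ∀ {ι : Type} (Z : Finset ι) (w : ι → ℝ), (∀ ρ ∈ Z, 0 ≤ w ρ) →
    ∀ (f : Fin q → ι → ℂ) (u : Fin r → ι → ℂ), 𝒞 Z w f u →
      0 ≤ Φ (configLin Z w f) (configGram Z w u)

/-- A configuration-valid Gram objective is valid on every constraint as a joint objective ignoring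
the linear data. [cite: Zhang2022LandauSiegel, §2 (2.18)–(2.19)] -/
theorem ConfigValid.validOn {q r : ℕ} {Φ : GramData r → ℝ} (hΦ : ConfigValid Φ)
    (𝒞 : ∀ {ι : Type}, Finset ι → (ι → ℝ) → (Fin q → ι → ℂ) → (Fin r → ι → ℂ) → Prop) :
    ConfigValidOn 𝒞 (fun _ G => Φ G) :=
  fun Z w hw _ u _ => hΦ Z w hw u

/-- Normalising the linear data by a real scale `X` is the linear data of the same configuration
with weights `w/X`. [cite: Zhang2022LandauSiegel, §2 (2.16)] -/
theorem configLin_div {ι : Type*} {q : ℕ} (Z : Finset ι) (w : ι → ℝ) (f : Fin q → ι → ℂ) (X : ℝ)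
    (a : Fin q) : configLin Z w f a / (X : ℂ) = configLin Z (fun ρ => w ρ / X) f a := by
  simp only [configLin, Finset.sum_div]
  refine Finset.sum_congr rfl fun ρ _ => ?_
  push_cast
  ring

/-- **Main order, joint form (Q3):** along a filter of stages carrying non-negative configurations
that satisfy a SCALE-INVARIANT constraint `𝒞` (invariant under `w ↦ w/X`, `X > 0` — true of every
constraint on the points / test values alone), if the normalised (linear, Gram) data converge to
`(ℓ, m)` and `Φ` is valid on `𝒞` and jointly continuous, then `0 ≤ Φ ℓ m`: no such endgame — CS,
POS, Gram minors, Turán-type power-sum inequalities, one-sided inequalities, counts — closes at main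
order on data that ARE limits of admissible non-negative configuration values.
[cite: Zhang2022LandauSiegel, §2 (2.16)–(2.19), Props 2.4–2.6 p. 6] -/
theorem ConfigValidOn.mainOrder_nonneg {q r : ℕ}
    {𝒞 : ∀ {ι : Type}, Finset ι → (ι → ℝ) → (Fin q → ι → ℂ) → (Fin r → ι → ℂ) → Prop}
    {Φ : LinData q → GramData r → ℝ} (hΦ : ConfigValidOn 𝒞 Φ)
    (hcont : Continuous fun p : LinData q × GramData r => Φ p.1 p.2)
    (h𝒞 : ∀ {ι : Type} (Z : Finset ι) (w : ι → ℝ) (f : Fin q → ι → ℂ) (u : Fin r → ι → ℂ) (X : ℝ),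
      0 < X → 𝒞 Z w f u → 𝒞 Z (fun ρ => w ρ / X) f u)
    {α : Type*} {l : Filter α} [l.NeBot] {ι : Type} (Z : α → Finset ι) (w : α → ι → ℝ)
    (f : α → Fin q → ι → ℂ) (u : α → Fin r → ι → ℂ) (X : α → ℝ)
    (hw : ∀ᶠ s in l, ∀ ρ ∈ Z s, 0 ≤ w s ρ) (hX : ∀ᶠ s in l, 0 < X s)
    (hC : ∀ᶠ s in l, 𝒞 (Z s) (w s) (f s) (u s)) {ℓ : LinData q} {m : GramData r}
    (hlim : Tendsto (fun s => ((fun a => configLin (Z s) (w s) (f s) a / (X s : ℂ)),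
        (fun a b => configGram (Z s) (w s) (u s) a b / (X s : ℂ)))) l (𝓝 (ℓ, m))) :
    0 ≤ Φ ℓ m := by
  have hT : Tendsto (fun s => Φ (fun a => configLin (Z s) (w s) (f s) a / (X s : ℂ))
      (fun a b => configGram (Z s) (w s) (u s) a b / (X s : ℂ))) l (𝓝 (Φ ℓ m)) :=
    (hcont.tendsto (ℓ, m)).comp hlim
  refine ge_of_tendsto hT ?_
  filter_upwards [hw, hX, hC] with s hws hXs hCs
  have hw' : ∀ ρ ∈ Z s, 0 ≤ w s ρ / X s := fun ρ hρ => div_nonneg (hws ρ hρ) hXs.le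
  have h := hΦ (Z s) (fun ρ => w s ρ / X s) hw' (f s) (u s) (h𝒞 (Z s) (w s) (f s) (u s) (X s) hXs hCs)
  have e1 : (fun a => configLin (Z s) (w s) (f s) a / (X s : ℂ)) =
      configLin (Z s) (fun ρ => w s ρ / X s) (f s) := funext fun a => configLin_div _ _ _ _ a
  have e2 : (fun a b => configGram (Z s) (w s) (u s) a b / (X s : ℂ)) =
      configGram (Z s) (fun ρ => w s ρ / X s) (u s) :=
    funext fun a => funext fun b => configGram_div _ _ _ _ a b
  rw [e1, e2]
  exact h

/-! ## Signed weights escape (B1): CS is NOT valid on signed configurations (F-det-6 / PLAN §0 W3) -/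

/-- **Cauchy–Schwarz is not configuration-universal for SIGNED weights** (the cell's F-det-6 / the
(α) door of `B-det/REF.md` R2-det-2): two sampled points with weights `+1, −1` and test values
`u = (1, 1)`, `v = (1, −1)` give `Ξ(u,u) = Ξ(v,v) = 0`, `Ξ(u,v) = 2`, so the CS objective is `−4 < 0`.
Hence nothing in this file constrains a sign-indefinite detector (PLAN §0 W3); its model check is per
design (PLAN §3 D2). [cite: Zhang2022LandauSiegel, §2 (2.18)–(2.19)] -/
theorem not_cauchySchwarz_signed :
    ¬ ∀ (Z : Finset (Fin 2)) (w : Fin 2 → ℝ) (u : Fin 2 → Fin 2 → ℂ),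
        0 ≤ csEndgame 0 1 (configGram Z w u) := by
  intro h
  have h0 := h Finset.univ ![1, -1] ![![1, 1], ![1, -1]]
  have hval : csEndgame 0 1 (configGram Finset.univ ![(1 : ℝ), -1] ![![(1 : ℂ), 1], ![1, -1]]) = -4 := by
    simp [csEndgame, configGram, discreteForm, Fin.sum_univ_two]
    norm_num
  linarith

end Literature.NumberTheory.LFunctions.Zhang2022.Det

/-! ## The skeleton link: a `Positive` detector's means form a configuration Gram array -/

namespace Literature.NumberTheory.LFunctions.Zhang2022.DetTemplate

open Skeleton Det

variable (Δ : Detector) {D : ℕ} [NeZero D] (χ : DirichletCharacter ℂ D)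

/-- **The Gram array of a detector's discrete means** of `r` test families on the sampled pairs.
[cite: Zhang2022LandauSiegel, §2 (2.16)–(2.17)] -/
def Detector.gram {r : ℕ} (u : Fin r → (_ : Chr D) × ℂ → ℂ) : GramData r :=
  fun a b => Δ.mean χ fun x ρ => u a ⟨x, ρ⟩ * conj (u b ⟨x, ρ⟩)

/-- On real weights the detector's Gram array IS the configuration Gram array of
`(Δ.idx χ, Re w, u)` (the bridge `mean_eq_discreteForm`). [cite: Zhang2022LandauSiegel, §2 (2.16)–(2.17)] -/
theorem Detector.gram_eq_configGram {r : ℕ} (hw : ∀ i ∈ Δ.idx χ, (Δ.wt D χ i.1 i.2).im = 0)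
    (u : Fin r → (_ : Chr D) × ℂ → ℂ) :
    Δ.gram χ u = configGram (Δ.idx χ) (fun i => (Δ.wt D χ i.1 i.2).re) u := by
  funext a b
  exact mean_eq_discreteForm Δ χ hw (u a) (u b)

/-- **Every configuration-valid endgame is `≥ 0` EXACTLY on the means of a `Positive` detector**, for
all large `D` and all test families (generalises `Detector.Positive.cauchySchwarz` from CS to every
valid endgame). [cite: Zhang2022LandauSiegel, §2 (2.16)–(2.19)] -/
theorem Detector.Positive.endgame_nonneg {Δ : Detector} (h : Δ.Positive) {r : ℕ}
    {Φ : GramData r → ℝ} (hΦ : ConfigValid Φ) :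
    ForAllLarge fun D _ χ => ∀ u : Fin r → (_ : Chr D) × ℂ → ℂ, 0 ≤ Φ (Δ.gram χ u) :=
  h.mono fun _ _ χ _ _ hD u => by
    have hw := wt_real_nonneg_of_mem_idx Δ χ hD
    rw [Δ.gram_eq_configGram χ (fun i hi => (hw i hi).1) u]
    exact hΦ (Δ.idx χ) _ (fun i hi => (hw i hi).2) u

end Literature.NumberTheory.LFunctions.Zhang2022.DetTemplate

end
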